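import Summits.HodgeConjecture.HodgeConjecture.Theorems.MarkmanPartnerTransportK3Sq2TypeHodgeOfPicardThree
import Summits.HodgeConjecture.HodgeConjecture.Theorems.MarkmanPartnerTransportPartnerTransportPicardRank
import Summits.HodgeConjecture.HodgeConjecture.Theorems.MarkmanPartnerTransportPicardThreeK3SquaresHighPicard
import Literature.AlgebraicGeometry.HodgeTheory.ComplexOrientationFamily

/-!
# Route MarkmanPartnerTransport · target `K3Sq2TypeHodge` (stmt-HodgeConjecture-19649) —
# the SECTOR `ρ(X) ≥ 18`: the Hodge conjecture for marked projective `K3^{[2]}`-type fourfolds of Picard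
# rank at least `18`, modulo seven published named facts

The route's thesis «every theorem about `HC(S × S)` becomes a theorem about `K3^{[2]}`-type fourfolds»,
instantiated at the known K3-square sector `ρ(S) ≥ 17` (`HighPicard.hodgeConjectureFor_square_of_seventeen_le`,
gen 0: at `ρ(S) ≥ 17` the endomorphism field is `ℚ` or CM — Morrison/Shioda–Inose range — so `HC⁴(S × S)`
by the tree's kernel theorem for `E = ℚ` and Buskin's theorem for CM):

* `hodgeConjectureFor_of_eighteen_le` — **HC⁴(X) for every marked smooth projective `K3^{[2]}`-type
  fourfold `X` with `ρ(X) ≥ 18`**, modulo {`Huybrechts_K3_periodSurjective_projective`,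
  `Beauville1983_hilbertSquare_markedIncidence`, `HilbertScheme.Beauville1983_hilbertSquare_blowupDiagonal_surjection`,
  `Markman2024_rationalHodgeIsometry_lift_algebraic_marked`, `Voisin2003_cupProduct_algebraicClasses`,
  `Buskin2019_hodgeIsometry_algebraic`, `Huybrechts_K3_marking_exists`}.

Proof: `PartnerExistence` (ρ(X) ≥ 4) gives a marked K3 partner `(S, g)`; along the marked Hilbert square
`ρ(X) ≤ ρ(S) + 1` (`finrank_algebraicClasses_le_partner_succ`), so `ρ(S) ≥ 17` and `HC⁴(S × S)` holds;
`PartnerTransport` concludes.  CONDITIONAL (credits nothing); a print-implied combination (Markman 2024 +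
Mukai/Shioda–Inose/Morrison + Buskin), not claimed as new mathematics.  No definition, no sorry.
Prover seat hodge-nonav-19652-p1 (gen 6), `--supports stmt-HodgeConjecture-19649`.

References: E. Markman, Compos. Math. 160 (2024) Thm. 1.1/1.4; N. Buskin, J. reine angew. Math. 755 (2019)
Thm. 1.1; B. van Geemen, Lemma 3.2 in *Real multiplication on K3 surfaces and Kuga–Satake varieties* (2008);
D. Huybrechts, *Lectures on K3 Surfaces* Ch. 3, 6, 7; A. Beauville, J. Differential Geom. 18 (1983) §6–9.
-/

noncomputable section

set_option linter.dupNamespace false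

open Module CategoryTheory MonoidalCategory
open Literature.AlgebraicTopology.SingularHomology
open Literature.AlgebraicGeometry Literature.AlgebraicGeometry.Motives Literature.AlgebraicGeometry.HodgeTheory
open Literature.AlgebraicGeometry.Hyperkaehler Literature.AlgebraicGeometry.Surfaces
open Literature.AlgebraicGeometry.HilbertScheme

namespace Summit.HodgeConjecture.HodgeConjecture.Theorems.MarkmanPartnerTransport.PartnerLattice

/-- `MarkedK3Sq[X, φ, P, z]`: VERBATIM the `let MarkedK3Sq := …` binder of the route declarations of
MarkmanPartnerTransport (clauses (m1)–(m6)). Local notation only. -/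
local notation3 (prettyPrint := false) "MarkedK3Sq[" X ", " φ ", " P ", " z "]" =>
  (((IsIntegralClass P ∧ ∀ Q : complexBetti X (2 * 4), IsIntegralClass Q → ∃ n : ℤ, Q = n • P) ∧
    (∀ c : complexBetti X 2, IsIntegralClass c ↔ ∃ v : K3HilbertIndex → ℤ, φ c = fun i => (v i : ℂ)) ∧
    (∀ a : complexBetti X 2, cupPowTwo a 4 = ((3 : ℂ) * (k3HilbertForm 2 (φ a) (φ a)) ^ 2) • P) ∧
    (IsOfHodgeType 4 X 2 2 0 (LinearEquiv.symm φ z) ∧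
      ∀ τ : complexBetti X 2, IsOfHodgeType 4 X 2 2 0 τ → ∃ t : ℂ, τ = t • LinearEquiv.symm φ z) ∧
    (∀ c : complexBetti X 2, IsOfHodgeType 4 X 2 1 1 c ↔
      (k3HilbertForm 2 (φ c) z = 0 ∧ k3HilbertForm 2 (φ c) (star z) = 0)) ∧
    (k3HilbertForm 2 z z = 0 ∧ 0 < (k3HilbertForm 2 (star z) z).re)))

/-- **The Hodge conjecture for marked projective `K3^{[2]}`-type fourfolds of Picard rank `≥ 18`**, modulo
seven published named facts (module docstring): partner `(S, g)` by `PartnerExistence`, `ρ(S) ≥ ρ(X) − 1 ≥ 17`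
along the marked Hilbert square, `HC⁴(S × S)` at `ρ(S) ≥ 17` (`E = ℚ` kernel theorem or Buskin for CM),
transport by `PartnerTransport`. [cite: Markman2024, §1.1 Thm. 1.1 and Thm. 1.4] [cite: Buskin2019, Thm. 1.1]
[cite: Vangeemen2008, Lemma 3.2] -/
theorem hodgeConjectureFor_of_eighteen_le (hP : Huybrechts_K3_periodSurjective_projective)
    (hB : Beauville1983_hilbertSquare_markedIncidence)
    (hρ : Beauville1983_hilbertSquare_blowupDiagonal_surjection)
    (hMk : Markman2024_rationalHodgeIsometry_lift_algebraic_marked)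
    (hcup : Voisin2003_cupProduct_algebraicClasses) (hBu : Buskin2019_hodgeIsometry_algebraic)
    (hmark : Huybrechts_K3_marking_exists)
    {X : SchemeOver ℂ} (hX : IsSmoothProjective 4 X) (hK : IsOfK3HilbertSquareType X)
    {φ : complexBetti X 2 ≃ₗ[ℂ] (K3HilbertIndex → ℂ)} {P : complexBetti X (2 * 4)} {z : K3HilbertIndex → ℂ}
    (hM : MarkedK3Sq[X, φ, P, z]) (h18 : 18 ≤ Module.finrank ℂ (algebraicClasses X 1)) :
    HodgeConjectureFor 4 X := by
  refine hodgeConjectureFor_of_square_partner hP hB hρ hMk hcup hX hK hM (by omega) ?_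
  intro S hS η p x g hSm hg _
  obtain ⟨hp0, hmk, hxx, hxpos, hu⟩ := hSm
  have hμ := hasPoincareDuality_complexOrientationFamily
  obtain ⟨H, hH, Ξ, φH, PH, -, -, hMH, θ, hθ, hi⟩ := hB complexOrientationFamily hμ S hS η p x hmk hxx hxpos hu
  have hle := finrank_algebraicClasses_le_partner_succ hcup hμ hX hM hS hp0 hmk.2.2.1 hmk.2.2.2.1
    hmk.2.2.2.2.1 hxpos hH hMH hθ hi hg.1 hg.2.2.2.1 hg.2.2.2.2.1
  exact HighPicard.hodgeConjectureFor_square_of_seventeen_le hBu hmark hS (by omega)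

end Summit.HodgeConjecture.HodgeConjecture.Theorems.MarkmanPartnerTransport.PartnerLattice

end
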